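import Summits.BirchSwinnertonDyer.BirchSwinnertonDyer.Theorems.EdixhovenFibreFiveSevenTwistDegreeStepFiveSevenKP
import Summits.BirchSwinnertonDyer.BirchSwinnertonDyer.Theorems.EdixhovenFibreFiveSevenTwistDegreeStepFiveSevenTorsTwist
import HarnessLib

/-!
# Route `EdixhovenFibreFiveSeven`, crux TDS57 (stmt-BirchSwinnertonDyer-22227): TDS57 BY NAME from F″ and the ONE
# remaining modular input L-TWIST — TORS-TWIST discharged (`--supports`)

Cell `pub/bsd-wall` (D-0145 line `route-BirchSwinnertonDyer-EdixhovenFibreFiveSeven`), seat `bsd-line-edix-p2`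
(prover). THEOREMS ONLY (no definition, no named fact, no `sorry`). Nothing is closed unconditionally and BSD is
not proved by this file.

The landed `TwistDegreeStepFiveSevenKP.twistDegreeStepFiveSeven_of_kato_of_twistInputs` reads
`F″ → L-TWIST → TORS-TWIST → TwistDegreeStepFiveSeven`. The input TORS-TWIST (a unit quadratic twist by a
non-residue kills the `ℚ_p`-rational `p`-torsion of the class) is now a THEOREM of the tree at the call site's
generality (`p ∈ {5, 7}`, the optimal member additive at `p`):
`TorsTwist.torsTwist57_input` (`Theorems/EdixhovenFibreFiveSevenTwistDegreeStepFiveSevenTorsTwist.lean`, route-free;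
prime-to-`p` isogeny transport of `ℚ_p`-rational `p`-torsion under `Irr` + the residues `c₄ ≡ −5 (25)` /
`c₆ ≡ 7 (49)` forced by a `p`-torsion point at an additive `p ∈ {5, 7}`). Hence:

`twistDegreeStepFiveSeven_of_kato_of_periodTwist : F″ → L-TWIST → TwistDegreeStepFiveSeven`,

where (L-TWIST) `hLT` is, verbatim as before: for `V₀/ℚ` globally minimal with `E[p]` irreducible (`p ≥ 5`), a
conductor-level datum `D₀`, an odd prime `q ≠ p` with `q ∤ N(V₀)`, a globally minimal model `Vχ` of `V₀ ⊗ χ_{q*}`,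
`s² = q*`, and every newform `g` of `Vχ`: `Λ(D₀.f) ⊆ s·Λ(g) + p·Λ(D₀.f)` — the twisted-period decomposition
(⟸ Ihara's lemma, tree fact `ModularForms.ribet1984_iharaLemma`, + Atkin–Li; memo TDS57-KP-RESIDUE-MEMO-v2 §2 on
the item). So, GRANTED F″ (cite-only, shared with K★ 22226 and TDS11 22228): TDS57 ⟸ L-TWIST alone.

References: [Stevens1989] §5 Lemma (5.2); [Ribet1984ICM] Thm. 4.1; [Kato2004Asterisque] (8.1.3), Thm. 9.7;
[Mazur1977] Ch. III §5, Step 1; [KostersPannekoek2017] Thm. 1, Cor. 2; [EdixhovenManin1991] §4.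
-/

set_option autoImplicit false
-- the Theorems directory repeats the summit name (sibling precedent `SignedBaseChangeAssembly.lean`)
set_option linter.dupNamespace false

noncomputable section

open scoped Classical MatrixGroups

open WeierstrassCurve NumberField Literature.NumberTheory.EllipticCurves
  Literature.NumberTheory.EllipticCurves.ModularForms
  Literature.NumberTheory.EllipticCurves.Rank1Residual
  Literature.NumberTheory.DiophantineGeometry IsDedekindDomain Rat.HeightOneSpectrum
  Summit.BirchSwinnertonDyer.Rank1Residual Summit.BirchSwinnertonDyer.Rank1Residual.Additive
  Summit.BirchSwinnertonDyer.BirchSwinnertonDyer.Theorems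
  Summit.BirchSwinnertonDyer.BirchSwinnertonDyer.Theses.EdixhovenFibreFiveSeven CongruenceSubgroup

namespace Summit.BirchSwinnertonDyer.BirchSwinnertonDyer.Theorems.TwistDegreeStepFiveSevenKPTors

/-- **TDS57 `TwistDegreeStepFiveSeven` (stmt-BirchSwinnertonDyer-22227) GRANTED F″ and the ONE remaining input
(L-TWIST) `hLT`** (the twisted-period decomposition `Λ(f) ⊆ s·Λ(f ⊗ χ) + p·Λ(f)`, ⟸ Ihara's lemma): the proof of
`TwistDegreeStepFiveSevenKP.twistDegreeStepFiveSeven_of_kato_of_twistInputs` with its input TORS-TWIST supplied by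
the theorem `TorsTwist.torsTwist57_input` (the call site has `p ∈ {5, 7}` and the optimal member `V₀` additive at
`p`). Off the Kosters–Pannekoek sub-residue: the tame-twist lever (`twistDegreeStep57_of_kato_of_noTorsion`); on it:
optimal member, Dirichlet's auxiliary prime `q` (`exists_auxPrime`), minimal model of the `q*`-twist, additivity of
the unit twist (`AddvUnitTwist.addv_of_model_twist_auxPrime`), TORS-TWIST, the lattice repair
(`TwistDegreeStepFiveSevenUnitTwist.exists_datum_not_dvd_c_of_kato_of_unitTwist`), and the step
(`twistDegreeStep57_of_not_dvd_c`). CONDITIONAL (F″ cite-only; L-TWIST not in the tree); BSD is not proved by this.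
[cite: Stevens1989, Lemma (5.2) p. 96] [cite: Ribet1984ICM, Thm. 4.1]
[cite: Kato2004Asterisque, (8.1.3) (p. 180), Thm. 9.7 (p. 189)] [cite: Mazur1977, Ch. III §5, Step 1, p. 158] -/
theorem twistDegreeStepFiveSeven_of_kato_of_periodTwist
    (hF : kato_neron_isIntegral_twistedSymbolSum_of_additive_five_le)
    (hLT : ∀ (p : ℕ) [Fact p.Prime] (q : ℕ) [Fact q.Prime] (V₀ : WeierstrassCurve ℚ) [V₀.IsElliptic]
      [V₀.IsGloballyMinimal] [NeZero (V₀.conductorNorm ℤ)]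
      (D₀ : ModularParametrizationData V₀ (V₀.conductorNorm ℤ)), 5 ≤ p → Irr V₀ p → q ≠ 2 → q ≠ p →
      ¬ q ∣ V₀.conductorNorm ℤ →
      ∀ (Vχ : WeierstrassCurve ℚ) [Vχ.IsElliptic] [Vχ.IsGloballyMinimal] (v : VariableChange ℚ),
      v • V₀.quadraticTwist (((-1 : ℤ) ^ (q / 2) * q : ℤ) : ℚ) = Vχ →
      ∀ (s : ℂ), s ^ 2 = (((-1 : ℤ) ^ (q / 2) * q : ℤ) : ℂ) →
      ∀ (N' : ℕ) [NeZero N'] (g : CuspForm (Gamma0 N') 2), IsNewformOf Vχ g →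
      ∀ z ∈ periodLattice D₀.f, ∃ w ∈ periodLattice g, ∃ y ∈ periodLattice D₀.f, z = s * w + (p : ℂ) * y) :
    TwistDegreeStepFiveSeven := by
  intro hnf p hp V _ _ _ Wf _ _ _ C hp57 hadd hirr hK hV4 hC
  have hp5 : 5 ≤ p := by omega
  by_cases hPT : ∀ (W' : WeierstrassCurve ℚ) [W'.IsElliptic] [W'.IsGloballyMinimal], IsIsogenous V W' →
      ∀ P : (W'.baseChange ℚ_[p]).toAffine.Point, p • P = 0 → P = 0
  · exact TwistDegreeStepFiveSeven.twistDegreeStep57_of_kato_of_noTorsion hF hnf V Wf C hp57 hadd hirr hK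
      hV4 hC hPT
  push Not at hPT
  obtain ⟨W', hE', hM', hisoW', P, hP, hP0⟩ := hPT
  -- the optimal member of the class of `V`
  obtain ⟨V₀, hE₀, hM₀, hNz₀, D₀, hiso, -, hopt₀⟩ := X12.exists_isIsogenous_optimal hnf V
  haveI := hE₀
  haveI := hM₀
  haveI := hNz₀
  have hirr₀ : Irr V₀ p := (X12.irr_iff_of_isIsogenous hiso p).mp hirr
  have hadd₀ : Addv V₀ p := (X2.addv_iff_of_isIsogenous (p := p) hiso).mp hadd
  have hisoVW : IsIsogenous V₀ W' := (hiso.symm_of_charZero).trans' hisoW'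
  -- the auxiliary prime
  obtain ⟨q, hqN, hq, hq2, hqp, hnsq⟩ := TwistDegreeStepFiveSevenKP.exists_auxPrime hp57 (V₀.conductorNorm ℤ)
  haveI : Fact q.Prime := ⟨hq⟩
  have hqN' : ¬ q ∣ V₀.conductorNorm ℤ := fun h ↦
    absurd (Nat.le_of_dvd (Nat.pos_of_ne_zero (NeZero.ne _)) h) (by omega)
  have hqsq : ¬ q ^ 2 ∣ V₀.conductorNorm ℤ := fun h ↦ hqN' ((dvd_pow_self q two_ne_zero).trans h)
  have hgm : V₀.HasGoodReductionAtPrime q ∨ V₀.HasMultiplicativeReductionAtPrime q :=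
    hasGoodReductionAtPrime_or_hasMultiplicativeReductionAtPrime_of_not_sq_dvd_conductorNorm (V := V₀) hqsq
  -- a globally minimal model of the twist, and a square root of `q*`
  obtain ⟨Vχ, hEχ, hMχ, v, hv⟩ := exists_minimal_twist_pStar q V₀
  haveI := hEχ
  haveI := hMχ
  haveI : NeZero (Vχ.conductorNorm ℤ) := ⟨(Vχ.conductorNorm_pos_holds).ne'⟩
  have hv' : v • V₀.quadraticTwist (((-1 : ℤ) ^ (q / 2) * q : ℤ) : ℚ) = Vχ := by
    rw [(pStar_intCast q).1]; exact hv
  obtain ⟨s, hs2⟩ := IsAlgClosed.exists_pow_nat_eq ((((-1 : ℤ) ^ (q / 2) * q : ℤ)) : ℂ) two_pos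
  -- ADDV-UNIT-TWIST and TORS-TWIST are theorems at `p ∈ {5, 7}`
  have haddχ : Addv Vχ p := AddvUnitTwist.addv_of_model_twist_auxPrime (by omega) hq hqp hadd₀ ⟨v, hv'⟩
  have hPTχ := TorsTwist.torsTwist57_input p q V₀ hp57 hadd₀ hirr₀ hqp hnsq ⟨W', hE', hM', P, hisoVW, hP0, hP⟩
    Vχ v hv'
  have hL := hLT p q V₀ D₀ hp5 hirr₀ hq2 hqp hqN' Vχ v hv' s hs2
  -- the repair and the step
  obtain ⟨D, hc⟩ :=
    TwistDegreeStepFiveSevenUnitTwist.exists_datum_not_dvd_c_of_kato_of_unitTwist hF hnf hp57 V hirr V₀ hiso D₀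
      hopt₀ hq2 hgm Vχ v hv' haddχ hPTχ s hs2 hL
  exact ⟨D, TwistDegreeStepFiveSeven.twistDegreeStep57_of_not_dvd_c hp5 V Wf hadd hK hV4 C hC D hc⟩

end Summit.BirchSwinnertonDyer.BirchSwinnertonDyer.Theorems.TwistDegreeStepFiveSevenKPTors

end
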